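import Mathlib
import HarnessLib
import Literature.Computability.Complexity.RangeAvoidance
import Literature.Computability.Complexity.LocalAvoidAlgorithms
import Summits.PneNP.PneNP.Theses.Nc03AvoidResidualCore
import Summits.PneNP.PneNP.Theorems.Nc03AvoidResidualCoreCandCutNormCertificate

/-!
# `CandCutNormSigningFP` — the cut-norm SIGNING target of the «sfm-bl» line (CONJECTURE leaf) and its
proved implications to the route items `CandAvoidLinearFP` (stmt-PneNP-20226) and
`CandMatchAvoidLinearFP` (stmt-PneNP-19962) of route-PneNP-Nc03AvoidResidualCore

FRONTIER F-N1c; nothing here bears on P vs NP.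

The line «sfm-bl» (cell pnp-ideate, pnp-ideate-p3/ROUND-15.md and PROOF-SFM-BL.md, 2026-08-27) attacks
pure-CAND range avoidance at linear stretch through a CERTIFICATE: a point `y ∈ {0,1}^m` is
*cut-certified* for the instance `I` when the bilinear functional
`∑_j χ(y_j)·σ(c_j)·(1 + φ(a_j) + φ(b_j))` stays `< m` for all `±1` vectors `σ, φ`
(`CutCertified`; `χ = boolSign`). By `cand_cut_certificate` (this directory) a cut-certified point is
outside `Range(I)`. The conjecture `CandCutNormSigningFP` says that ONE polynomial-time function prints a
cut-certified point for every pure-CAND instance with `m ≥ C·n`; the claimed proof (derandomised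
Bilu–Linial signing of a sparse remainder + deterministic first-moment accounting on dense spots) is under
audit in the cell and NOT asserted here. Proved here: `CandCutNormSigningFP → CandAvoidLinearFP` and
`→ CandMatchAvoidLinearFP` (so the conjecture is a sufficient typed target for rung F-N1c's residual X₁).
-/

namespace Summit.PneNP.PneNP.Theorems.CandCutNorm

open Finset Literature.Computability.Complexity

/-- A point `y` is CUT-CERTIFIED for the 3-local instance `I` (roles `c_j = vars j 0`, `a_j = vars j 1`,
`b_j = vars j 2`): for all `±1` vectors `σ, φ` on the variables,
`∑_j χ(y_j)·σ(c_j)·(1 + φ(a_j) + φ(b_j)) < m`. For pure-CAND `I` this forces `y ∉ Range(I)`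
(`cand_cut_certificate`). -/
def CutCertified {n m : ℕ} (I : LocalMap 3 n m) (y : Fin m → Bool) : Prop :=
  ∀ (σ φ : Fin n → ℤ), (∀ i, σ i = 1 ∨ σ i = -1) → (∀ i, φ i = 1 ∨ φ i = -1) →
    ∑ j, boolSign (y j) * σ (I.vars j 0) * (1 + φ (I.vars j 1) + φ (I.vars j 2)) < (m : ℤ)

/-- A cut-certified point of a pure-CAND instance lies outside its range. -/
theorem not_mem_range_of_cutCertified {n m : ℕ} (I : LocalMap 3 n m) (hI : I.IsPure candPred)
    (y : Fin m → Bool) (hy : CutCertified I y) : y ∉ I.range :=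
  cand_cut_certificate I hI y hy

/-- OPEN CONJECTURE — `CandCutNormSigningFP` (**cut-norm signing for pure-CAND at linear stretch is in
FP**): there are an absolute constant `C` and ONE polynomial-time string function `f` such that for every
pure-CAND 3-local instance `I` with `n ≥ 1` inputs and `m ≥ C·n` outputs, the first `m` bits of
`f (encode I)` form a CUT-CERTIFIED point of `I`. Posed by the cell pnp-ideate (seat p3, ROUND-15 line
«sfm-bl», 2026-08-27) as the typed target of its derandomised-signing argument; it refines the open
question whether `NC⁰₃-AVOID` at stretch `m = O(n)` is in FP, for which the best printed algorithm needs
`m ≥ c·n·log n` [cite: GuruswamiLyuYuan2025, §1 (Theorem: NC⁰₃-AVOID ∈ FP for m ≥ c n log n; linear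
stretch open)]. [status: open]
Status: open — a claimed proof (PROOF-SFM-BL.md) is under audit in the cell; nothing is asserted here.
Users take `(h : CandCutNormSigningFP)`; `candAvoidLinearFP_of_cutNormSigningFP h` is then the route
item `CandAvoidLinearFP`. -/
@[conjecture] def CandCutNormSigningFP : Prop :=
  ∃ C : ℕ, ∃ f : List Bool → List Bool, IsPolyTime f ∧
    ∀ n m (I : LocalMap 3 n m), I.IsPure candPred → 0 < n → C * n ≤ m →
      CutCertified I (readOut m (f I.encode))

/-- `CandCutNormSigningFP → CandAvoidLinearFP` (route item stmt-PneNP-20226): the same constant and the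
same function; its output is outside the range by the certificate. -/
theorem candAvoidLinearFP_of_cutNormSigningFP (h : CandCutNormSigningFP) :
    Summit.PneNP.PneNP.Theses.Nc03AvoidResidualCore.CandAvoidLinearFP := by
  obtain ⟨C, f, hf, hC⟩ := h
  exact ⟨C, f, hf, fun n m I hI hn hm =>
    not_mem_range_of_cutCertified I hI _ (hC n m I hI hn hm)⟩

/-- `CandCutNormSigningFP → CandMatchAvoidLinearFP` (route item stmt-PneNP-19962, the residual X₁ of rung
F-N1c): restrict to matching-class instances (antitonicity of `LocalAvoidLinearFP`). -/
theorem candMatchAvoidLinearFP_of_cutNormSigningFP (h : CandCutNormSigningFP) :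
    Summit.PneNP.PneNP.Theses.Nc03AvoidResidualCore.CandMatchAvoidLinearFP :=
  LocalAvoidLinearFP.anti (fun _ _ _ hI => hI.1) (candAvoidLinearFP_of_cutNormSigningFP h)

end Summit.PneNP.PneNP.Theorems.CandCutNorm
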